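import Summits.Ventures.PercRepro.Orbit

/-!
# PercRepro — C-023 «ORBIT-k, k ≤ 7»: mine-2's per-orbit block-count inequalities for `k` marks (typer-2, gen 5)

`conjectures/CONJECTURES.md` row C-023 (lead 10:51:33Z; mine-2 M2-10 10:40:58Z with the correction 10:49:00Z):
for a multigraph with `k` marks, an interval `[I, I ⊔ D]` (`I ⊓ D = ⊥`), the counts `c_l = intervalCount`
(`#{A ≤ D : N(I ⊔ A) = l}`) and `a_ij = antipodalCount` (`#{A ≤ D : N(I ⊔ A) = i ∧ N(I ⊔ (D ⊓ Aᶜ)) = j}`)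
satisfy, for `1 ≤ i < j ≤ k` with `j − i ≥ 2`,

  `Σ_{i<l<j} c_l ≥ κ(i, j; k) · a_ij`,  `Φ(p, q) := Σ_{q<u<p} C(p+q, u) / C(p+q, p)`,
  `κ = Φ(j, i)` if `i + j ≤ k`, `Φ(j−1, i−1)` if `i + j = k + 1`, `Φ(k+1−i, k+1−j)` if `i + j ≥ k + 2`

(tight cores: the all-marked cycle `C_{i+j}`, an all-marked forest with `2k − i − j` edges, the star
`K_{1, 2k+2−i−j}` with unmarked centre). FILED FOR `k ≤ 7` only: at `k = 8` the theta graph `Θ(3,3,3)` gives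
`(2,5) = 255/81 < 10/3`, so beyond `k = 7` the formula is an upper bound on the sharp constant (mine-2
10:49:00Z, lead-verified). `k = 3` is C-021 (`κ(1,3;3) = 2`), `k = 4` is C-022 (`3/2, 3/2, 6`) — checked below.

* `phiK`, `kappaK` — the constants (rationals); `kappaK_three`, `kappaK_four_*` — the C-021 / C-022 values;
* **`MultiGraph.OrbitK`** — the inequality on one interval for one pair `(i, j)` (in `ℚ`);
* **`C023`** — every finite multigraph, every `k ≤ 7`, every `k`-marking, every interval, every admissible pair;
* `C023Upper` — the `k ≥ 8` refinement (every `k`, the pairs with `i + j ≥ k`): NOT part of the C-023 row (mine-2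
  10:57:14Z), a separate conjecture recorded as a shape;
* `orbitK_three_iff` — for `k = 3`, `(i, j) = (1, 3)`, `OrbitK` is exactly `Orbit2`.
-/

namespace PercRepro

open Finset

/-- `Φ(p, q) = Σ_{q<u<p} C(p+q, u) / C(p+q, p)`. -/
def phiK (p q : ℕ) : ℚ :=
  (∑ u ∈ Finset.Ioo q p, (Nat.choose (p + q) u : ℚ)) / (Nat.choose (p + q) p : ℚ)

/-- The constant `κ(i, j; k)` of ORBIT-k: the three-family formula. -/
def kappaK (i j k : ℕ) : ℚ :=
  if i + j ≤ k then phiK j i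
  else if i + j = k + 1 then phiK (j - 1) (i - 1)
  else phiK (k + 1 - i) (k + 1 - j)

/-- `Finset.Ioo 0 2 = {1}`. -/
theorem ioo_zero_two : Finset.Ioo 0 2 = {1} := by decide

/-- `Finset.Ioo 1 3 = {2}`. -/
theorem ioo_one_three : Finset.Ioo 1 3 = {2} := by decide

/-- `Finset.Ioo 0 3 = {1, 2}`. -/
theorem ioo_zero_three : Finset.Ioo 0 3 = {1, 2} := by decide

/-- `κ(1, 3; 3) = 2` — C-021's constant. -/
theorem kappaK_three : kappaK 1 3 3 = 2 := by
  unfold kappaK phiK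
  norm_num [ioo_zero_two]

/-- `κ(1, 3; 4) = 3/2` — C-022 (Q13). -/
theorem kappaK_four_13 : kappaK 1 3 4 = 3 / 2 := by
  unfold kappaK phiK
  norm_num [ioo_one_three, show Nat.choose 4 2 = 6 from rfl]

/-- `κ(2, 4; 4) = 3/2` — C-022 (Q24). -/
theorem kappaK_four_24 : kappaK 2 4 4 = 3 / 2 := by
  unfold kappaK phiK
  norm_num [ioo_one_three, show Nat.choose 4 2 = 6 from rfl]

/-- `κ(1, 4; 4) = 6` — C-022 (Q14). -/
theorem kappaK_four_14 : kappaK 1 4 4 = 6 := by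
  unfold kappaK phiK
  norm_num [ioo_zero_three, Finset.sum_pair]

namespace MultiGraph

variable {V E : Type*} (G : MultiGraph V E) [DecidableEq V] [Fintype V] [Fintype E] [DecidableEq E]

/-- **ORBIT-k on one interval for the pair `(i, j)`**: `κ(i, j; k) · a_ij ≤ Σ_{i<l<j} c_l` (in `ℚ`). -/
def OrbitK {k : ℕ} (m : Fin k → V) (I D : Config E) (i j : ℕ) : Prop :=
  kappaK i j k * (G.antipodalCount m I D i j : ℚ) ≤ ∑ l ∈ Finset.Ioo i j, (G.intervalCount m I D l : ℚ)

/-- `OrbitK` is decidable on finite data. -/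
instance {k : ℕ} (m : Fin k → V) (I D : Config E) (i j : ℕ) : Decidable (G.OrbitK m I D i j) := by
  unfold OrbitK; infer_instance

/-- For three marks and the pair `(1, 3)`, ORBIT-k is ORBIT-2. -/
theorem orbitK_three_iff (a b c : V) (I D : Config E) :
    G.OrbitK ![a, b, c] I D 1 3 ↔ G.Orbit2 a b c I D := by
  unfold OrbitK Orbit2
  rw [kappaK_three]
  rw [ioo_one_three, Finset.sum_singleton]
  exact_mod_cast Iff.rfl

end MultiGraph

/-- **C-023 = ORBIT-k for `k ≤ 7`** (mine-2 M2-10; CONJECTURES v56): every finite multigraph, every `k ≤ 7`,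
every `k`-marking, every interval `[I, I ⊔ D]` and every pair `1 ≤ i`, `i + 2 ≤ j ≤ k`. (Intervals with
`a_ij = 0` are trivial, so no orbit restriction is needed.) -/
def C023 : Prop :=
  ∀ {V E : Type} [DecidableEq V] [Fintype V] [Fintype E] [DecidableEq E] (G : MultiGraph V E)
    (k : ℕ), k ≤ 7 → ∀ (m : Fin k → V) (I D : Config E), I ⊓ D = ⊥ →
      ∀ i j : ℕ, 1 ≤ i → i + 2 ≤ j → j ≤ k → G.OrbitK m I D i j

/-- **The `k ≥ 8` refinement (lead's remark 10:52:25Z; mine-2 10:57:14Z: NOT part of the C-023 row — a separate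
conjecture, typed here for the record only)**: for EVERY `k` the inequality with the three-family constant on
the pairs with `i + j ≥ k` (where the constant is conjectured sharp; for `i + j ≤ k − 1` it is strictly too
large from `k = 8` on, so those pairs are excluded). -/
def C023Upper : Prop :=
  ∀ {V E : Type} [DecidableEq V] [Fintype V] [Fintype E] [DecidableEq E] (G : MultiGraph V E)
    (k : ℕ) (m : Fin k → V) (I D : Config E), I ⊓ D = ⊥ →
      ∀ i j : ℕ, 1 ≤ i → i + 2 ≤ j → j ≤ k → k ≤ i + j → G.OrbitK m I D i j

end PercRepro
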